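import Mathlib
import Summits.NavierStokesRegularity.NavierStokesRegularity.Theorems.L3TimeExponentPincerRingDatumVelocity
import HarnessLib.Audit
import HarnessLib

/-!
# L3TimeExponentPincer — ring datum calculus IX: the `max(a, |x|²)^{-3}` speed bound

Support kernel for the crux `L3CascadeJaw` (item stmt-NavierStokesRegularity-19499): combines
`norm_ringField_sq_le` (`‖u₀‖² ≤ 8(s²F'(s)² + F(s)²)`, `s = |x|²`) with the profile bounds of
`…RingDatumProfile` (`|F'| ≤ K s^{-5/2}` on `s ≥ a`, `F' = 0` below `a`, `|F| ≤ (2K/3) s^{-3/2}` on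
`s ≥ a`, `|F| ≤ (2K/3) a^{-3/2}` below `a`) into the energy-upper-bound integrand
`‖u₀(x)‖² ≤ (104/9) K² / max(a, |x|²)³` (`sq_le_of_profile_bounds`, `norm_ringField_sq_le_max`).
WHAT THIS IS NOT: real arithmetic only.
-/

namespace Summit.NavierStokesRegularity.NavierStokesRegularity.Theorems.L3TimeExponentPincerRingDatumSpeedBound

open Real Literature.Analysis.FluidPDE
open Summit.NavierStokesRegularity.NavierStokesRegularity.Theorems.L3TimeExponentPincerRingDatumVelocity

/-- `(s^{-3/2})² = (s³)⁻¹` for `s > 0`. -/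
theorem rpow_neg_three_halves_sq {s : ℝ} (hs : 0 < s) : (s ^ (-(3 / 2 : ℝ))) ^ 2 = (s ^ 3)⁻¹ := by
  rw [← Real.rpow_natCast (s ^ (-(3 / 2 : ℝ))) 2, ← Real.rpow_mul hs.le,
    show (-(3 / 2 : ℝ)) * ((2 : ℕ) : ℝ) = -((3 : ℕ) : ℝ) by norm_num, Real.rpow_neg hs.le,
    Real.rpow_natCast]

/-- `s² (s^{-5/2})² = (s³)⁻¹` for `s > 0`. -/
theorem sq_mul_rpow_neg_five_halves_sq {s : ℝ} (hs : 0 < s) :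
    s ^ 2 * (s ^ (-(5 / 2 : ℝ))) ^ 2 = (s ^ 3)⁻¹ := by
  rw [← Real.rpow_natCast (s ^ (-(5 / 2 : ℝ))) 2, ← Real.rpow_mul hs.le,
    show (-(5 / 2 : ℝ)) * ((2 : ℕ) : ℝ) = -((5 : ℕ) : ℝ) by norm_num, Real.rpow_neg hs.le,
    Real.rpow_natCast, show s ^ 5 = s ^ 2 * s ^ 3 by ring, mul_inv, ← mul_assoc,
    mul_inv_cancel₀ (pow_ne_zero 2 hs.ne'), one_mul]

/-- **Real-arithmetic core**: the profile bounds give `8(s²f₁² + f²) ≤ (104/9)K²/max(a,s)³`. -/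
theorem sq_le_of_profile_bounds {K a s f f₁ : ℝ} (ha : 0 < a)
    (h₁ : a ≤ s → |f₁| ≤ K * s ^ (-(5 / 2 : ℝ))) (h₁' : s < a → f₁ = 0)
    (h₀ : a ≤ s → |f| ≤ (2 * K / 3) * s ^ (-(3 / 2 : ℝ)))
    (h₀' : s < a → |f| ≤ (2 * K / 3) * a ^ (-(3 / 2 : ℝ))) :
    8 * (s ^ 2 * f₁ ^ 2 + f ^ 2) ≤ (104 / 9) * K ^ 2 * ((max a s) ^ 3)⁻¹ := by
  rcases lt_or_ge s a with hs | hs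
  · -- below the core: `f₁ = 0`, `|f| ≤ (2K/3) a^{-3/2}`
    rw [max_eq_left hs.le, h₁' hs]
    have hf : f ^ 2 ≤ ((2 * K / 3) * a ^ (-(3 / 2 : ℝ))) ^ 2 := by
      rw [← sq_abs f]; exact pow_le_pow_left₀ (abs_nonneg _) (h₀' hs) 2
    rw [mul_pow, rpow_neg_three_halves_sq ha] at hf
    have h3 : 0 ≤ (a ^ 3)⁻¹ := by positivity
    nlinarith [mul_nonneg (sq_nonneg K) h3]
  · have hs0 : 0 < s := ha.trans_le hs
    rw [max_eq_right hs]
    have hf : f ^ 2 ≤ ((2 * K / 3) * s ^ (-(3 / 2 : ℝ))) ^ 2 := by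
      rw [← sq_abs f]; exact pow_le_pow_left₀ (abs_nonneg _) (h₀ hs) 2
    have hf₁ : s ^ 2 * f₁ ^ 2 ≤ s ^ 2 * (K * s ^ (-(5 / 2 : ℝ))) ^ 2 := by
      refine mul_le_mul_of_nonneg_left ?_ (sq_nonneg _)
      rw [← sq_abs f₁]; exact pow_le_pow_left₀ (abs_nonneg _) (h₁ hs) 2
    rw [mul_pow, rpow_neg_three_halves_sq hs0] at hf
    rw [mul_pow, ← mul_assoc, mul_comm (s ^ 2) (K ^ 2), mul_assoc,
      sq_mul_rpow_neg_five_halves_sq hs0] at hf₁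
    have h3 : 0 ≤ (s ^ 3)⁻¹ := by positivity
    nlinarith [mul_nonneg (sq_nonneg K) h3]

variable {F : ℝ → ℝ} {K a : ℝ}

/-- **Energy upper-bound integrand**: under the profile bounds,
`‖u₀(x)‖² ≤ (104/9) K² / max(a, |x|²)³`. -/
theorem norm_ringField_sq_le_max (hF : Differentiable ℝ F) (ha : 0 < a)
    (h₁ : ∀ s, a ≤ s → |deriv F s| ≤ K * s ^ (-(5 / 2 : ℝ))) (h₁' : ∀ s, s < a → deriv F s = 0)
    (h₀ : ∀ s, a ≤ s → |F s| ≤ (2 * K / 3) * s ^ (-(3 / 2 : ℝ)))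
    (h₀' : ∀ s, s < a → |F s| ≤ (2 * K / 3) * a ^ (-(3 / 2 : ℝ))) (x : EuclideanSpace ℝ (Fin 3)) :
    ‖curl (fun y : EuclideanSpace ℝ (Fin 3) => F (‖y‖ ^ 2) • rotGen y) x‖ ^ 2 ≤
      (104 / 9) * K ^ 2 * ((max a (‖x‖ ^ 2)) ^ 3)⁻¹ :=
  (norm_ringField_sq_le hF x).trans
    (sq_le_of_profile_bounds ha (h₁ _) (h₁' _) (h₀ _) (h₀' _))

end Summit.NavierStokesRegularity.NavierStokesRegularity.Theorems.L3TimeExponentPincerRingDatumSpeedBound
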